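import Summits.QuantumFields.YangMills.Theorems.BalabanUVNodesN18StepMatchedLetter
import Summits.QuantumFields.YangMills.Theorems.BalabanUVNodesN17KnitTransfer

/-!
# BalabanUVNodes ∕ N18 — THE STEP-MATCHED N18 LETTER ON THE AF-FREE RATE-LOSS ROAD: (D4) `ReadOutAt` + the step-matched letter + N22 ⟹ the N27 joins' `hU2` SLOT SHAPE
# `D.UnderHypotheses Hβ (fun g₀ ↦ U2Output D g₀ (2(cr·C₅·θ)∕(1−ρ′)) ρ′)` — the step-matched twin of the slot's supplier of record `…N17KnitTransfer.u2Output_under_of_u3edge_gap`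
# (there: the BOX letter `∀ b, NE5 EA (EB b) W`; here: NE5 at the step-matched pairs only, read along run B's prefixes)
# (Track A, DAG node N18 = NE5 → U2 → the `hU2` slot; key K3⁸ `SpineGivenEndpointR13SepCoPHV` = stmt-QuantumFields-27366, skeleton v6 b4e55110ab73e679; width seat `pub-ymgap-dag-n18-w1`
# g7, FILE 3 — successor of FILE 1 `…N18StepMatchedLetter` (`shiftAlongRun_of_readOutAt_stepMatched`); the along-run rate-loss step is dag-n17-w3 g5's `…N17RunWindowShiftU2Door`
# §1 `disc_le_gap_of_runWindowShift` (p636624) with its run-window input `hW` replaced by `NE7MarginalL1Currency.ShiftAlongRun` — the shape FILE 1 produces)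

HONEST FRAMING.  Count-neutral kernel bookkeeping BY NAME (`--kind proof --supports stmt-QuantumFields-27366 --as helper`): `NE7MarginalL1Runs.disc_step_along` +
`T4CurrencyMatching.twoSided_fixedPoint_rateLoss` + `…N17KnitTransfer.gapWindow_of_small_box` + `T4BetaReadOutLipschitz.histLipschitz_of_ne9_on` + `T4BetaReadOut.fadingMemory_readOut`
+ FILE 1, composed.  The step-matched letter, (D4), N22's kernel NE9 + fading memory, the printed-type upper bound `BetaUpperH` and every rate letter are DISPLAYED HYPOTHESES
(under the ym-nodeO F-E finding `FadingMemory` is the presumptively-dead binder here exactly as in the supplier of record — displayed, not repaired); nothing of Bałaban's is asserted,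
inhabited, discharged or refuted; NE4 ∕ NE5 ∕ NE9 NOT PRINTED for d = 4 and NOT proved; N17 ∕ N18 ∕ N22 ∕ (D4) NOT discharged; K3⁸ OPEN (v6), no stub proved ∕ refuted, NO skeleton
re-keyed; K3⁷ 20544 aside.  Counts UNMOVED (typed 28∕28 · discharged 5∕27, A 5∕28).  One finite four-torus programme at fixed `ε`, Bałaban AS PRINTED; route R4 closes ONLY the
conditional finite-𝕋⁴ rung `BalabanLadder.UV` — NOT the continuum limit, NOT ℝ⁴, NOT OS, NOT the Yang–Mills mass gap, NOT Clay.  THEOREMS ONLY: 0 `def`, 0 `instance`, 0 `sorry`,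
standard axioms.

WHAT (theorems only).  §7 generic `β : HBeta`: ★ `disc_le_gap_of_shiftAlongRun` (two IR-pinned in-window runs, `ShiftAlongRun (c·θ^·) β g^B K`, `HistLipschitz Λ` ∧ `FadingMemory C ω Λ`
with a strict memory gap `ω < ρ`, output rate `ρ ∈ [θ,1[`, box weight `(g^A_i)²g^B_{i+1} ≤ γ³`, window `C·γ³·ρ∕(ρ−ω) ≤ (1−ρ)∕2` ⟹ `disc_j ≤ (2c∕(1−ρ))ρ^j`; NO β lower bound).
§8 K3 carriers (`YMDAG.UVSplit`): ★★ `u2Output_of_readOutAt_stepMatched_gap` (`ReadOutAt D u` + the step-matched letter for `D.βfun` + the history half at a level `γ ≤ u.γ` + a sequence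
tuned within `]0,γ]` + the γ³-window ⟹ `U2Output D g₀ (2(u.cr·u.C₅·u.θ)∕(1−ρ)) ρ`) · ★★★ `underHypotheses_u2Output_of_readOutAt_stepMatched_n22At_gap` ((D4) ∧ step-matched letter ∧
`N22At u` + `BetaUpperH β′ u.γ` with `u.γ²β′ < 1` + ANY `ρ′ ∈ ]u.ρ, 1[` ⟹ `D.UnderHypotheses Hβ (fun g₀ ↦ U2Output D g₀ (2(u.cr·u.C₅·u.θ)∕(1−ρ′)) ρ′)`, threshold
`γ₀ := min(u.γ, 1, (1−ρ′)(ρ′−u.ω)∕(ρ′(2·u.cr·u.C₉·u.ω+1)))`; NO `EventualLowerH`, NO window binder, NO box conjunct `N18At`, (B)∕`Hβ` unused) ·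
`underHypotheses_u2Output_of_readOutAt_n18At_n22At_gap` (sanity: today's box conjunct ⟹ the same, by FILE 1 `stepMatched_of_n18At`).

References (TYPES ∕ locators only): [Balaban1987RG1] CMP **109** (1987): (0.18)–(0.20) pp. 255–256, Thm 1 ∕ 2 p. 259, (1.20)–(1.22) ∕ Thm 3 p. 264, §5 p. 298.
-/

noncomputable section

namespace YMDAG.N18.StepMatchedLetter

open Finset
open Literature.MathematicalPhysics.QuantumFieldTheory.Balaban1983to89
open Literature.MathematicalPhysics.QuantumFieldTheory.Balaban1983to89.T4Continuum (T4Family)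
open Literature.MathematicalPhysics.QuantumFieldTheory.Balaban1983to89.FlowStep (Box HBeta mem_box prefixOf prefixOf_apply RGEqH BetaUpperH box_mono)
open Literature.MathematicalPhysics.QuantumFieldTheory.Balaban1983to89.T4CouplingMatching (HistLipschitz FadingMemory disc disc_nonneg disc_pin prefixOf_mem_box)
open Literature.MathematicalPhysics.QuantumFieldTheory.Balaban1983to89.T4TwoRunUniqueness (rgEqH_of_tuned)
open Literature.MathematicalPhysics.QuantumFieldTheory.Balaban1983to89.T4OutputRate (Carriers Functional Window NE5 mem_window)
open Literature.MathematicalPhysics.QuantumFieldTheory.Balaban1983to89.T4CurrencyMatching (twoSided_fixedPoint_rateLoss)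
open Summit.QuantumFields.BalabanUV.T4Continuum.NE7MarginalL1Currency (ShiftAlongRun)
open Summit.QuantumFields.BalabanUV.T4Continuum.NE7MarginalL1Runs (disc_step_along)
open Summit.QuantumFields.BalabanUV.T4Continuum.Spine.NE4 (runFlow U2Output box_and_pin_of_tuned)
open Summit.QuantumFields.YangMills.Theorems.BalabanUVNodesN17 (gapWindow_of_small_box)
open YMDAG.UVSplit

/-! ## §7 Generic `β : HBeta`: node U2's AF-FREE RATE-LOSS form with the shift consumed ALONG RUN B's PREFIXES (`ShiftAlongRun`) -/

section Generic

variable {β : HBeta} {γ : ℝ}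

/-- ★ **NODE U2's AF-FREE RATE-LOSS MATCHING FROM NE4 ALONG RUN B** (dag-n17-w3's `disc_le_gap_of_runWindowShift` with its run-window input replaced by
`NE7MarginalL1Currency.ShiftAlongRun (fun j ↦ c·θ^j) β g^B K` — the shape node N18's step-matched letter produces, FILE 1 `shiftAlongRun_of_readOutAt_stepMatched`).  Two IR-pinned runs of
(0.20) (A: `K` steps, B: `K+1`, couplings in `]0,γ]`, `g^A_K = g^B_{K+1}`), the history half `HistLipschitz Λ γ β` ∧ `FadingMemory C ω Λ` with a STRICT memory gap `0 ≤ ω < ρ`,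
output rate `ρ ∈ [θ,1[`, the box weight `(g^A_i)²g^B_{i+1} ≤ γ³` (NO weight SUM, hence NO β lower bound ∕ asymptotic freedom), ONE window `C·γ³·ρ∕(ρ−ω) ≤ (1−ρ)∕2` ⟹
`|1∕(g^A_j)² − 1∕(g^B_{j+1})²| ≤ (2c∕(1−ρ))·ρ^j` for `j ≤ K` (`disc_step_along` + `twoSided_fixedPoint_rateLoss` BY NAME).  Every β-side hypothesis UNPRINTED; bookkeeping.
[cite: Balaban1987RG1, (0.20) p.256, Thm 2 p.259 and §5 p.298] -/
theorem disc_le_gap_of_shiftAlongRun {c θ ω ρ C : ℝ} {Λ : ℕ → ℕ → ℝ} {K : ℕ} {gA gB : ℕ → ℝ}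
    (hρ0 : 0 < ρ) (hρ1 : ρ < 1) (hθ0 : 0 ≤ θ) (hθρ : θ ≤ ρ) (hω0 : 0 ≤ ω) (hωρ : ω < ρ) (hc : 0 ≤ c) (hC : 0 ≤ C)
    (hA : RGEqH K β gA) (hB : RGEqH (K + 1) β gB)
    (hAbox : ∀ i, i ≤ K → 0 < gA i ∧ gA i ≤ γ) (hBbox : ∀ i, i ≤ K + 1 → 0 < gB i ∧ gB i ≤ γ) (hpin : gA K = gB (K + 1))
    (hS : ShiftAlongRun (fun j => c * θ ^ j) β gB K) (hL : HistLipschitz Λ γ β) (hΛ : FadingMemory C ω Λ)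
    (hsmall : C * γ ^ 3 * (ρ / (ρ - ω)) ≤ (1 - ρ) / 2) :
    ∀ j, j ≤ K → disc gA gB j ≤ 2 * c / (1 - ρ) * ρ ^ j := by
  have hu : ∀ i, i ≤ K → 0 ≤ (gA i) ^ 2 * gB (i + 1) ∧ (gA i) ^ 2 * gB (i + 1) ≤ γ ^ 3 := by
    intro i hi
    have hgA := hAbox i hi
    have hgB := hBbox (i + 1) (by omega)
    refine ⟨mul_nonneg (sq_nonneg _) hgB.1.le, ?_⟩
    have h1 : (gA i) ^ 2 ≤ γ ^ 2 := pow_le_pow_left₀ hgA.1.le hgA.2 2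
    calc (gA i) ^ 2 * gB (i + 1) ≤ γ ^ 2 * γ := mul_le_mul h1 hgB.2 hgB.1.le (sq_nonneg _)
      _ = γ ^ 3 := by ring
  refine twoSided_fixedPoint_rateLoss (u := fun i => (gA i) ^ 2 * gB (i + 1)) (ubar := γ ^ 3)
    hρ0 hρ1 hθ0 hθρ hω0 hωρ hc hC (disc_nonneg gA gB) hu hsmall (disc_pin hpin) ?_
  intro j hj
  have hstep := disc_step_along hA hB hAbox hBbox hL (fun k i hik => (hΛ k i hik).1) hj (hS j hj)
  have hsum : ∑ i ∈ range (j + 1), Λ j i * ((gA i) ^ 2 * gB (i + 1)) * disc gA gB i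
      ≤ C * ∑ i ∈ range (j + 1), ω ^ (j - i) * ((gA i) ^ 2 * gB (i + 1)) * disc gA gB i := by
    rw [Finset.mul_sum]
    refine Finset.sum_le_sum fun i hi => ?_
    have hij : i ≤ j := Nat.lt_succ_iff.mp (mem_range.mp hi)
    have hiK : i ≤ K := by omega
    have hnn : 0 ≤ (gA i) ^ 2 * gB (i + 1) * disc gA gB i := mul_nonneg (hu i hiK).1 (disc_nonneg _ _ _)
    calc Λ j i * ((gA i) ^ 2 * gB (i + 1)) * disc gA gB i
        = Λ j i * ((gA i) ^ 2 * gB (i + 1) * disc gA gB i) := by ring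
      _ ≤ C * ω ^ (j - i) * ((gA i) ^ 2 * gB (i + 1) * disc gA gB i) := mul_le_mul_of_nonneg_right (hΛ j i hij).2 hnn
      _ = C * (ω ^ (j - i) * ((gA i) ^ 2 * gB (i + 1)) * disc gA gB i) := by ring
  have e : (fun j => c * θ ^ j) j = c * θ ^ j := rfl
  linarith [hstep, hsum, e]

end Generic

/-! ## §8 K3 carriers: (D4) `ReadOutAt D u` + the step-matched letter (+ N22) ⟹ node U2's output on the AF-free road; the `hU2` slot shape under the targets' prefix -/

section Carriers

variable {F : T4Family} {N : ℕ} [NeZero N]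

/-- ★★ **NODE U2's OUTPUT ON THE DATUM FROM (D4) + THE STEP-MATCHED LETTER, AF-FREE RATE-LOSS ROAD** (the step-matched twin of `…N17KnitTransfer.u2Output_of_N17_gap` ∕ dag-n17-w3's
`u2Output_of_runWindowShift_gap`).  `ReadOutAt D u` and the step-matched letter for `D.βfun` at `u` (FILE 1: ⟹ `ShiftAlongRun (u.cr·u.C₅·u.θ·u.θ^·)` along every in-window run);
the history half of node U2's triple at a level `γ ≤ u.γ` (`HistLipschitz Λ γ D.βfun`, `FadingMemory C ω Λ`, strict gap `0 ≤ ω < ρ`, output rate `ρ ∈ [u.θ,1[`); the printed-type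
`BetaUpperH β′ u.γ D.βfun` with `u.γ²β′ < 1` (only to run (0.20) forward); a sequence tuned to `g` within `]0,γ]`; the γ³-window `C·γ³·ρ∕(ρ−ω) ≤ (1−ρ)∕2`.  THEN
`U2Output D g₀ (2(u.cr·u.C₅·u.θ)∕(1−ρ)) ρ`.  NO `EventualLowerH`, NO box conjunct `N18At`. [cite: Balaban1987RG1, (0.20) p.256 and Thm 2 p.259] -/
theorem u2Output_of_readOutAt_stepMatched_gap (D : Datum F N) {u : U3Carriers} (hD4 : ReadOutAt D u)
    (hSM : ∀ b, 0 < b → b ≤ u.γ → ∀ s ∈ u.W, 1 / b ^ 2 = 1 / (s 0) ^ 2 + D.βfun 0 (fun _ => b) →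
      ∀ (U : u.C.BgB) (X : u.C.Dom), |u.EA s (u.C.transport U) X - u.EB b s U X| ≤ u.C₅ * u.θ ^ u.C.scale X * Real.exp (-(u.κ * u.C.d X)))
    {Λ : ℕ → ℕ → ℝ} {C ω ρ γ β' g : ℝ} {g₀ : ℕ → ℝ}
    (hθρ : u.θ ≤ ρ) (hρ0 : 0 < ρ) (hρ1 : ρ < 1) (hω0 : 0 ≤ ω) (hωρ : ω < ρ) (hC : 0 ≤ C)
    (hL : HistLipschitz Λ γ D.βfun) (hΛ : FadingMemory C ω Λ)
    (hγ : 0 < γ) (hγle : γ ≤ u.γ) (hhi : BetaUpperH β' u.γ D.βfun) (hγβ : u.γ ^ 2 * β' < 1) (ht : D.Tuned γ g g₀)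
    (hsmall : C * γ ^ 3 * (ρ / (ρ - ω)) ≤ (1 - ρ) / 2) :
    U2Output D g₀ (2 * (u.cr * u.C₅ * u.θ) / (1 - ρ)) ρ := by
  have hsigns : 0 ≤ u.cr ∧ 0 ≤ u.C₅ ∧ 0 ≤ u.θ := by obtain ⟨_, _, _, _, -, -, -, -, -, -, -, hcr, hC₅, hθ, -⟩ := hD4; exact ⟨hcr, hC₅, hθ⟩
  have hc : 0 ≤ u.cr * u.C₅ * u.θ := mul_nonneg (mul_nonneg hsigns.1 hsigns.2.1) hsigns.2.2
  obtain ⟨hbox, hpin⟩ := box_and_pin_of_tuned D ht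
  have hrun : ∀ K, RGEqH K D.βfun (runFlow D g₀ K) := fun K => rgEqH_of_tuned D hhi hγβ hγ hγle ht K
  intro K j hj
  refine ⟨disc_nonneg _ _ _, ?_⟩
  -- the step-matched letter gives NE4 along run `K+1`'s prefixes (FILE 1), run `K+1` read in the larger window `]0,u.γ]`
  have hstep0 := hrun (K + 1) 0 (Nat.succ_pos K)
  rw [prefixOf_zero_eq_const] at hstep0
  have hS : ShiftAlongRun (fun j => u.cr * u.C₅ * u.θ * u.θ ^ j) D.βfun (runFlow D g₀ (K + 1)) K :=
    shiftAlongRun_of_readOutAt_stepMatched D hD4 hSM (by simpa using hstep0) fun i hi => ⟨(hbox (K + 1) i hi).1, (hbox (K + 1) i hi).2.trans hγle⟩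
  have h := disc_le_gap_of_shiftAlongRun hρ0 hρ1 hsigns.2.2 hθρ hω0 hωρ hc hC (hrun K) (hrun (K + 1)) (hbox K) (hbox (K + 1))
    ((hpin K).trans (hpin (K + 1)).symm) hS hL hΛ hsmall j hj
  simpa using h

/-- ★★★ **THE N27 JOINS' `hU2` SLOT SHAPE FROM (D4) ∧ THE STEP-MATCHED LETTER ∧ N22 — AF-FREE, WINDOW DISCHARGED BY γ SMALL** (the step-matched twin of the slot's supplier of record
`…N17KnitTransfer.u2Output_under_of_u3edge_gap`, whose N18 input is the BOX letter `∀ b, NE5 EA (EB b) W`).  At carriers `u`: `ReadOutAt D u` (the read-out binders, letter signs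
`0 ≤ u.cr, u.C₅, u.θ, u.ω`, `u.θ, u.ω ≤ u.ρ`), the step-matched letter for `D.βfun`, `N22At u` (kernel NE9 with moduli `u.Λ` + fading memory `u.C₉, u.ω` — whence `D.βfun`'s history
half `HistLipschitz (u.cr·u.Λ(·+1)) u.γ` ∧ `FadingMemory (u.cr·u.C₉·u.ω) u.ω` by `T4BetaReadOutLipschitz.histLipschitz_of_ne9_on` ∕ `T4BetaReadOut.fadingMemory_readOut`), the printed-type
`BetaUpperH β′ u.γ D.βfun` with `u.γ²β′ < 1`, and ANY output rate `ρ′ ∈ ]u.ρ, 1[`.  THEN `D.UnderHypotheses Hβ (fun g₀ ↦ U2Output D g₀ (2(u.cr·u.C₅·u.θ)∕(1−ρ′)) ρ′)` with threshold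
`γ₀ := min(u.γ, 1, (1−ρ′)(ρ′−u.ω)∕(ρ′(2·(u.cr·u.C₉·u.ω)+1)))` (`gapWindow_of_small_box`).  NO `EventualLowerH`, NO window binder, NO box conjunct; `Hβ` ∕ (B) unused.  Every β-side
binder UNPRINTED ∕ displayed. [cite: Balaban1987RG1, (0.20) p.256, Thm 2 p.259, (1.20)–(1.22) p.264, §5 p.298] -/
theorem underHypotheses_u2Output_of_readOutAt_stepMatched_n22At_gap (D : Datum F N) {u : U3Carriers} (hD4 : ReadOutAt D u)
    (hSM : ∀ b, 0 < b → b ≤ u.γ → ∀ s ∈ u.W, 1 / b ^ 2 = 1 / (s 0) ^ 2 + D.βfun 0 (fun _ => b) →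
      ∀ (U : u.C.BgB) (X : u.C.Dom), |u.EA s (u.C.transport U) X - u.EB b s U X| ≤ u.C₅ * u.θ ^ u.C.scale X * Real.exp (-(u.κ * u.C.d X)))
    (h22 : N22At u) {Hβ : Prop} {ρ' β' : ℝ} (hρρ' : u.ρ < ρ') (hρ'1 : ρ' < 1)
    (hγ : 0 < u.γ) (hhi : BetaUpperH β' u.γ D.βfun) (hγβ : u.γ ^ 2 * β' < 1) :
    D.UnderHypotheses Hβ fun g₀ => U2Output D g₀ (2 * (u.cr * u.C₅ * u.θ) / (1 - ρ')) ρ' := by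
  obtain ⟨𝒜A, 𝒜B, rA, rB, hW, hA, hB, h𝒜A, h𝒜B, hr, hcov, hcr, hC₅, hθ, hω, hθρ, hωρ⟩ := hD4
  have hD4 : ReadOutAt D u := ⟨𝒜A, 𝒜B, rA, rB, hW, hA, hB, h𝒜A, h𝒜B, hr, hcov, hcr, hC₅, hθ, hω, hθρ, hωρ⟩
  have hL : HistLipschitz (fun k i => u.cr * u.Λ (k + 1) i) u.γ D.βfun := T4BetaReadOutLipschitz.histLipschitz_of_ne9_on hW h22.1 hA h𝒜A hr
  have hM : FadingMemory (u.cr * u.C₉ * u.ω) u.ω (fun k i => u.cr * u.Λ (k + 1) i) := T4BetaReadOut.fadingMemory_readOut h22.2 hcr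
  have hC₉ : 0 ≤ u.C₉ := T4BetaReadOut.fadingMemory_const_nonneg h22.2
  have hC : 0 ≤ u.cr * u.C₉ * u.ω := mul_nonneg (mul_nonneg hcr hC₉) hω
  have hρ'0 : 0 < ρ' := lt_of_le_of_lt (hθ.trans hθρ) hρρ'
  have hωρ' : u.ω < ρ' := lt_of_le_of_lt hωρ hρρ'
  have hθρ' : u.θ ≤ ρ' := (hθρ.trans hρρ'.le)
  intro _ _
  have hWpos : 0 < (1 - ρ') * (ρ' - u.ω) / (ρ' * (2 * (u.cr * u.C₉ * u.ω) + 1)) :=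
    div_pos (mul_pos (by linarith) (by linarith)) (mul_pos hρ'0 (by linarith))
  refine ⟨min u.γ (min 1 ((1 - ρ') * (ρ' - u.ω) / (ρ' * (2 * (u.cr * u.C₉ * u.ω) + 1)))), lt_min hγ (lt_min one_pos hWpos),
    fun γ hγ' hγle => ⟨1, one_pos, fun g _ _ g₀ ht => ?_⟩⟩
  have hγu : γ ≤ u.γ := hγle.trans (min_le_left _ _)
  have hγ1 : γ ≤ 1 := hγle.trans ((min_le_right _ _).trans (min_le_left _ _))
  have hγW : γ ≤ (1 - ρ') * (ρ' - u.ω) / (ρ' * (2 * (u.cr * u.C₉ * u.ω) + 1)) := hγle.trans ((min_le_right _ _).trans (min_le_right _ _))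
  have hwin : u.cr * u.C₉ * u.ω * γ ^ 3 * (ρ' / (ρ' - u.ω)) ≤ (1 - ρ') / 2 := by
    have h := gapWindow_of_small_box (C := 2 * (u.cr * u.C₉ * u.ω)) (by positivity) hωρ' hρ'0 hρ'1 hγ' hγ1 hγW
    have e : 2 * (u.cr * u.C₉ * u.ω) * (γ ^ 3 / 2) * (ρ' / (ρ' - u.ω)) = u.cr * u.C₉ * u.ω * γ ^ 3 * (ρ' / (ρ' - u.ω)) := by ring
    linarith [h, e]
  exact u2Output_of_readOutAt_stepMatched_gap D hD4 hSM hθρ' hρ'0 hρ'1 hω hωρ' hC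
    (fun k p q hp hq => hL k p q (box_mono hγu k hp) (box_mono hγu k hq)) hM hγ' hγu hhi hγβ ht hwin

/-- Sanity (today's conjunct is STRONGER): with the BOX conjunct `N18At u` in place of the step-matched letter the same `hU2` shape follows (FILE 1 `stepMatched_of_n18At`) — the
re-keying R-N18-SEL costs the N27 joins' `hU2` slot NOTHING on this road either. [cite: Balaban1987RG1, Thm 1 ∕ Thm 2 p.259] -/
theorem underHypotheses_u2Output_of_readOutAt_n18At_n22At_gap (D : Datum F N) {u : U3Carriers} (hD4 : ReadOutAt D u) (h18 : N18At u) (h22 : N22At u)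
    {Hβ : Prop} {ρ' β' : ℝ} (hρρ' : u.ρ < ρ') (hρ'1 : ρ' < 1) (hγ : 0 < u.γ) (hhi : BetaUpperH β' u.γ D.βfun) (hγβ : u.γ ^ 2 * β' < 1) :
    D.UnderHypotheses Hβ fun g₀ => U2Output D g₀ (2 * (u.cr * u.C₅ * u.θ) / (1 - ρ')) ρ' :=
  underHypotheses_u2Output_of_readOutAt_stepMatched_n22At_gap D hD4 (stepMatched_of_n18At h18 D.βfun) h22 hρρ' hρ'1 hγ hhi hγβ

end Carriers

end YMDAG.N18.StepMatchedLetter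

end
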